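import Mathlib
import Summits.MatrixMultiplication.MatrixMultiplication.Theorems.SnSubsetDichotomyNoThresholdSubsetTriplePlancherelStepDefs

/-!
# Definition: the drift hypothesis (L1*) of the (Q)-programme (route `SnSubsetDichotomy`, crux `NoThresholdSubsetTriple`)

The ONE open deterministic input of the quadratic-variation half (Q) of the Freedman architecture for J′ (lead c7 report
`Cruxes/NoThresholdSubsetTriple/Lines/klr_graded_polynomial_method-lead-c7.md` §2a; crux workfile `Lines/klr_dev_rungs2.lean`), as a
named route hypothesis: a Lyapunov shape functional `V ≥ 0`, `V ∅ = 0`, whose one-step Plancherel drift on the `3√n`-box is at most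
`K − c·q(ν)/√n` (`q = PlancherelStep.sqEnergy`), with increments `≤ b√n` and conditional second moment `≤ C(q+1)`.  Numerically the
inverse-local-density renormalised charge energy passes on every family probed (n ≤ 6400); no proof is known.  Everything else of (Q) is
in the tree (`selfBounding_timeSum_tail_two`, `condExp_prefix_succ`, `sq_change_le`, `condVar_le`, …), so that (Q) for the Plancherel
growth holds MODULO this hypothesis (`pairQV_tail_of_drift`, landed separately).
-/

noncomputable section

open scoped BigOperators
open Literature.RepresentationTheory.FiniteGroups (addableNodes)

namespace Summit.MatrixMultiplication.MatrixMultiplication.Theorems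

set_option linter.dupNamespace false

namespace PlancherelStep

/-- **(L1*) — the drift hypothesis.** There are a shape functional `V` and constants `K, c, b, C` (`c, b, C > 0`) with `V ∅ = 0`,
`0 ≤ V ν` on Young diagrams, and, for every `n` and every Young diagram `ν` with at most `n` cells inside the `3√n`-box:
restoring drift `Σ_z p_z (V(ν∪z) − V(ν)) ≤ K − c·q(ν)/√n`, bounded increments `|V(ν∪z) − V(ν)| ≤ b√n` for every corner `z`, and
conditional second moment `Σ_z p_z (V(ν∪z) − V(ν))² ≤ C(q(ν) + 1)` (`p = transProb`, `q = sqEnergy`).  OPEN (lead c7 report §2a: the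
pointwise choice `V = q` fails asymptotically on thin parity-aligned tails; `V = q +` renormalised energy passes numerically). -/
def DriftHypothesis : Prop :=
  ∃ (V : Finset (ℕ × ℕ) → ℝ) (K c b C : ℝ), 0 < c ∧ 0 < b ∧ 0 < C ∧ V ∅ = 0 ∧
    (∀ ν : Finset (ℕ × ℕ), IsLowerSet (ν : Set (ℕ × ℕ)) → 0 ≤ V ν) ∧
    ∀ (n : ℕ) (ν : Finset (ℕ × ℕ)), IsLowerSet (ν : Set (ℕ × ℕ)) → ν.card ≤ n →
      (∀ x ∈ ν, (x.1 : ℝ) < 3 * Real.sqrt n ∧ (x.2 : ℝ) < 3 * Real.sqrt n) →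
        (∑ z ∈ addableNodes ν, transProb ν z * (V (insert z ν) - V ν) ≤ K - c * sqEnergy ν / Real.sqrt n) ∧
        (∀ z ∈ addableNodes ν, |V (insert z ν) - V ν| ≤ b * Real.sqrt n) ∧
        (∑ z ∈ addableNodes ν, transProb ν z * (V (insert z ν) - V ν) ^ 2 ≤ C * (sqEnergy ν + 1))

end PlancherelStep

/-- Anchor: the drift hypothesis provides a nonnegative functional vanishing at the empty diagram (trivial unpacking). -/
theorem driftHypothesis_nonneg : PlancherelStep.DriftHypothesis →
    ∃ V : Finset (ℕ × ℕ) → ℝ, V ∅ = 0 ∧ ∀ ν : Finset (ℕ × ℕ), IsLowerSet (ν : Set (ℕ × ℕ)) → 0 ≤ V ν := by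
  rintro ⟨V, _, _, _, _, _, _, _, h0, hV, _⟩
  exact ⟨V, h0, hV⟩

end Summit.MatrixMultiplication.MatrixMultiplication.Theorems

end
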